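import Summits.MatrixMultiplication.MatrixMultiplication.Theorems.SaturationLadderCornerModulus
import HarnessLib

/-!
# Route `SaturationLadder` on Strassen's spectrum, XX: THE NEGATION OF THE CRUX IN DUST-DIRECTION FORM — what a refuter of `h₁` must exhibit

decomp-mm lens 1 «grading / quantitative ladder», gen 50, kernel K50-N (critic ask g50 SECOND: «`not_subexpSaturation_iff`, the
refuter-facing statement»).  Def-free, sorry-free support module beneath the deciding crux `SubexpSaturation`
(stmt-MatrixMultiplication-25909) of `route-MatrixMultiplication-SaturationLadder`; cut of record UNCHANGED
(`closes (h₁ : SubexpSaturation) (h₂ : SubexpToPoly) (h₃ : PolyToFinite) (h₄ : TailDescentTwo) (h₅ : SquareFromTwo)`).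

For a universal spectral point `φ` over `ℂ` write `θ = specMMPoint ℂ φ`, darkness `d = θ₀+θ₁+θ₂−2`, and logarithmic
height-to-depth ratio `u = log(θ₁/(1−θ₂))` (off the face `θ₂ = 1`).  Kernel III (`subexpSaturation_iff_modulus`) proved
`h₁ ⟺ κ*(ℂ) = 0`: for every `κ > 0` the MODULUS LAW `d·u ≤ κ·θ₁` holds at all universal points with `u ≥ u₀(κ)`; and
the law is a THEOREM for every `κ > c₂ = (5 log(5/4) + 3 log 2)/3 = 1.0650…` (`modulus_above_classCeiling`).
Here the crux is NEGATED once and for all, in the three forms a refuter can aim at (pure logic over kernel III):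
* `not_subexpSaturation_iff`: `¬h₁ ⟺ ∃ κ > 0 ∀ u₀ ∃ φ` universal over `ℂ` with `θ₂ < 1`, `u ≥ u₀` and `κ·θ₁ < d·u` —
  a POSITIVE CORNER MODULUS witnessed at unbounded height;
* `not_subexpSaturation_iff_le_classCeiling`: the same with `κ ≤ c₂` for free (larger `κ` are refuted by the lineage's
  certified thin rates) — so a refutation of `h₁` lives in the window `κ ∈ (0, 1.0650…]`;
* `not_subexpSaturation_iff_seq`: `¬h₁ ⟺ ∃ κ > 0` and a SEQUENCE `φₙ` of universal spectral points over `ℂ` off the face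
  `θ₂ = 1` with `uₙ → ∞` ("dust direction": `θ₂(φₙ) → 1` while `θ₁/(1−θ₂) → ∞`) and `κ·θ₁(φₙ) < dₙ·uₙ` for every `n`.
Every universal spectral point over `ℂ` known in print (the gauge points; the Christandl–Vrana–Zuiddam quantum functionals)
has darkness `d = 0` in these coordinates, so each form is OPEN — this is the exact shape a counterexample to `h₁` must
have (a universal point DARK near the face `θ₂ = 1`, quantitatively), not a claim either way.
Tags: `SubexpSaturation` (h₁) NEC·WEAKER·ATTACKED (unchanged) · negation form for refuters.  No defs.
[cite: Strassen1988, Thm. 3.8] [cite: Strassen1991, §6] [cite: ChristandlVranaZuiddam2023, Thm. 1.1] [cite: Zuiddam2018, Ch. 4]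
[cite: CoppersmithWinograd1990, §8] [cite: AlmanDuanVassilevskaWilliamsXuXuZhou2025, §3.4]
-/

set_option linter.dupNamespace false

noncomputable section

namespace Summit.MatrixMultiplication.MatrixMultiplication.Theorems.SaturationLadderDustDirection

open Literature.Computability.AlgebraicComplexity
open Summit.MatrixMultiplication.MatrixMultiplication.Theses.SaturationLadder
open Summit.MatrixMultiplication.MatrixMultiplication.Theorems.SaturationLadderCornerModulus
open Filter

/-- ★★ **`¬h₁ ⟺` a positive corner modulus at unbounded height.**  `SubexpSaturation` FAILS iff there is `κ > 0` such
that for every `u₀` some universal spectral point `φ` over `ℂ` has `θ₂ < 1`, `log(θ₁/(1−θ₂)) ≥ u₀` and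
`κ·θ₁ < (θ₀+θ₁+θ₂−2)·log(θ₁/(1−θ₂))`. [cite: Strassen1988, Thm. 3.8] [cite: AlmanDuanVassilevskaWilliamsXuXuZhou2025, §3.4] -/
theorem not_subexpSaturation_iff :
    ¬ SubexpSaturation ↔ ∃ κ : ℝ, 0 < κ ∧ ∀ u₀ : ℝ, ∃ F : SpectralMap ℂ, IsUniversalSpectralPoint ℂ F ∧
      specMMPoint ℂ F 2 < 1 ∧ u₀ ≤ Real.log (specMMPoint ℂ F 1 / (1 - specMMPoint ℂ F 2)) ∧
        κ * specMMPoint ℂ F 1 <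
          (specMMPoint ℂ F 0 + specMMPoint ℂ F 1 + specMMPoint ℂ F 2 - 2) *
            Real.log (specMMPoint ℂ F 1 / (1 - specMMPoint ℂ F 2)) := by
  rw [subexpSaturation_iff_modulus]
  push Not
  exact Iff.rfl

/-- ★★ **The refutation window is `κ ∈ (0, c₂]`.**  `¬h₁` iff some `κ` with `0 < κ ≤ c₂ = (5 log(5/4) + 3 log 2)/3 = 1.0650…`
has the modulus law `d·u ≤ κ·θ₁` violated at unbounded height — every `κ > c₂` is excluded by the certified thin rates
(`modulus_above_classCeiling`). [cite: CoppersmithWinograd1990, §8] [cite: Strassen1988, Thm. 3.8] -/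
theorem not_subexpSaturation_iff_le_classCeiling :
    ¬ SubexpSaturation ↔ ∃ κ : ℝ, 0 < κ ∧ κ ≤ (5 * Real.log (5 / 4) + 3 * Real.log 2) / 3 ∧
      ∀ u₀ : ℝ, ∃ F : SpectralMap ℂ, IsUniversalSpectralPoint ℂ F ∧
        specMMPoint ℂ F 2 < 1 ∧ u₀ ≤ Real.log (specMMPoint ℂ F 1 / (1 - specMMPoint ℂ F 2)) ∧
          κ * specMMPoint ℂ F 1 <
            (specMMPoint ℂ F 0 + specMMPoint ℂ F 1 + specMMPoint ℂ F 2 - 2) *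
              Real.log (specMMPoint ℂ F 1 / (1 - specMMPoint ℂ F 2)) := by
  rw [subexpSaturation_iff_modulus_le_classCeiling]
  push Not
  exact Iff.rfl

/-- ★★ **`¬h₁` in DUST-DIRECTION (sequence) form.**  `SubexpSaturation` FAILS iff there are `κ > 0` and a sequence `φₙ` of
universal spectral points over `ℂ` off the face `θ₂ = 1` whose height-to-depth logarithms `uₙ = log(θ₁/(1−θ₂)) → ∞`
(so `θ₂(φₙ) → 1`) while `κ·θ₁(φₙ) < (θ₀+θ₁+θ₂−2)(φₙ)·uₙ` for every `n` — the object a refuter of the crux must construct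
(every universal point over `ℂ` in print — gauge points, quantum functionals — has darkness `0`).
[cite: Strassen1991, §6] [cite: ChristandlVranaZuiddam2023, Thm. 1.1] [cite: Zuiddam2018, Ch. 4]
[cite: Strassen1988, Thm. 3.8] -/
theorem not_subexpSaturation_iff_seq :
    ¬ SubexpSaturation ↔ ∃ κ : ℝ, 0 < κ ∧ ∃ Φ : ℕ → SpectralMap ℂ,
      (∀ n, IsUniversalSpectralPoint ℂ (Φ n)) ∧ (∀ n, specMMPoint ℂ (Φ n) 2 < 1) ∧
      Tendsto (fun n => Real.log (specMMPoint ℂ (Φ n) 1 / (1 - specMMPoint ℂ (Φ n) 2))) atTop atTop ∧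
      ∀ n, κ * specMMPoint ℂ (Φ n) 1 <
        (specMMPoint ℂ (Φ n) 0 + specMMPoint ℂ (Φ n) 1 + specMMPoint ℂ (Φ n) 2 - 2) *
          Real.log (specMMPoint ℂ (Φ n) 1 / (1 - specMMPoint ℂ (Φ n) 2)) := by
  rw [not_subexpSaturation_iff]
  constructor
  · rintro ⟨κ, hκ, h⟩
    choose Φ hΦ using fun n : ℕ => h n
    refine ⟨κ, hκ, Φ, fun n => (hΦ n).1, fun n => (hΦ n).2.1, ?_, fun n => (hΦ n).2.2.2⟩
    refine tendsto_atTop_atTop.2 fun b => ⟨⌈b⌉₊, fun n hn => ?_⟩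
    exact (Nat.le_ceil b).trans ((Nat.cast_le.2 hn).trans (hΦ n).2.2.1)
  · rintro ⟨κ, hκ, Φ, hU, h2, hT, hlt⟩
    refine ⟨κ, hκ, fun u₀ => ?_⟩
    obtain ⟨N, hN⟩ := tendsto_atTop_atTop.1 hT u₀
    exact ⟨Φ N, hU N, h2 N, hN N le_rfl, hlt N⟩

/-- ★ **Contrapositive packaging for provers of `h₁`**: the crux holds iff NO `κ > 0` admits such a dust sequence. -/
theorem subexpSaturation_iff_no_dust :
    SubexpSaturation ↔ ∀ κ : ℝ, 0 < κ → ∀ Φ : ℕ → SpectralMap ℂ,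
      (∀ n, IsUniversalSpectralPoint ℂ (Φ n)) → (∀ n, specMMPoint ℂ (Φ n) 2 < 1) →
      Tendsto (fun n => Real.log (specMMPoint ℂ (Φ n) 1 / (1 - specMMPoint ℂ (Φ n) 2))) atTop atTop →
      ∃ n, (specMMPoint ℂ (Φ n) 0 + specMMPoint ℂ (Φ n) 1 + specMMPoint ℂ (Φ n) 2 - 2) *
          Real.log (specMMPoint ℂ (Φ n) 1 / (1 - specMMPoint ℂ (Φ n) 2)) ≤ κ * specMMPoint ℂ (Φ n) 1 := by
  have h := not_subexpSaturation_iff_seq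
  constructor
  · intro hS κ hκ Φ hU h2 hT
    by_contra hne
    push Not at hne
    exact (h.2 ⟨κ, hκ, Φ, hU, h2, hT, hne⟩) hS
  · intro hall
    by_contra hS
    obtain ⟨κ, hκ, Φ, hU, h2, hT, hlt⟩ := h.1 hS
    obtain ⟨n, hn⟩ := hall κ hκ Φ hU h2 hT
    exact absurd (hlt n) (not_lt.2 hn)

end Summit.MatrixMultiplication.MatrixMultiplication.Theorems.SaturationLadderDustDirection

end
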